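/-
Origin: written from primary sources — A. Deitmar, S. Echterhoff, *Principles of Harmonic Analysis*, 2nd ed.
(2014) §7.3 (isotypes); A. Weil, Acta Math. 111 (1964) Chap. III n° 37 (the Weil representation of a dual pair
as a representation of the product group). Adapted: no. Elementary linear algebra: the joint eigenspace
("weight space", "`χ`-isotypic subspace for a one-dimensional type") of a family of operators of a
representation, and its stability under every operator commuting with the family. Kernel only, Mathlib only.
-/
import Mathlib.RepresentationTheory.Basic
import Mathlib.LinearAlgebra.Eigenspace.Basic
import Mathlib.Topology.Algebra.Module.Basic
import HarnessLib

/-!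
# Weight spaces (one-dimensional isotypic subspaces) of a representation and their stability

For a representation `ρ : Representation R G V` (`= G →* End V`), a family of group elements `ι : T → G` and
prescribed eigenvalues `w : T → R`:

* `weightSpace ρ ι w := ⨅ t, eigenspace (ρ (ι t)) (w t)` (namespace `Literature.RepresentationTheory`) — the
  joint eigenspace
  `{v | ∀ t, ρ (ι t) v = w t • v}` (`mem_weightSpace`); for `ι` a homomorphism from a subgroup `K` and `w` a
  character of `K` this is the `w`-ISOTYPIC SUBSPACE of `ρ|_K` (Deitmar–Echterhoff §7.3 for one-dimensional types);
* **`map_mem_weightSpace_of_commute`** — if `ρ g` commutes with every `ρ (ι t)` (in particular if `g` commutes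
  with every `ι t`), then `ρ g` maps the weight space into itself; `weightSpace_map_le_of_commute`;
* the product-group case (`weightSpace_stable_inr`): for `ρ : Representation R (K × H) V` and the weights of the
  first factor `k ↦ (k, 1)`, every `ρ (1, h)` preserves the weight space — `(k,1)(1,h) = (1,h)(k,1)`;
* `isClosed_weightSpace` — closed whenever the operators `ρ (ι t)` are continuous for a topology on `V` making
  scalar multiplication by constants continuous (`T2Space V`).

Provenance / use (Hodge-CM model-construction cell): the index space `𝒮^κ` of PerL's isolation step is the
`κ`-isotypic subspace of the adelic Schwartz–Bruhat space for the maximal compact `K_∞` of `U(V)(ℝ)` acting through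
the Weil representation of the pair `U(V) × U(W)`; its stability under `U(W)(𝔸)` is `weightSpace_stable_inr`.
The same pattern for CONTINUOUS representations is `ContRepresentation.weightSpace`
(`NumberTheory/Automorphic/HilbertRepIsotypicSubrepresentations`); this file is the plain-`Representation`
version and does not import it.
-/

namespace Literature.RepresentationTheory

variable {R : Type*} [CommRing R] {G : Type*} [Monoid G] {V : Type*} [AddCommGroup V] [Module R V]

/-- The **weight space** (joint eigenspace) of the operators `ρ (ι t)`, `t : T`, for the eigenvalues `w t`:
`⨅ t, eigenspace (ρ (ι t)) (w t)`. For `ι : K →* G` and `w` a character this is the `w`-isotypic subspace of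
`ρ|_K`. (Deitmar–Echterhoff, Principles of Harmonic Analysis §7.3, one-dimensional types) [folklore] -/
def weightSpace (ρ : Representation R G V) {T : Type*} (ι : T → G) (w : T → R) : Submodule R V :=
  ⨅ t, Module.End.eigenspace (ρ (ι t)) (w t)

variable {ρ : Representation R G V} {T : Type*} {ι : T → G} {w : T → R}

/-- Membership: `v` is in the weight space iff `ρ (ι t) v = w t • v` for every `t`. [folklore] -/
theorem mem_weightSpace {v : V} : v ∈ weightSpace ρ ι w ↔ ∀ t, ρ (ι t) v = w t • v := by
  simp only [weightSpace, Submodule.mem_iInf, Module.End.mem_eigenspace_iff]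

/-- **Stability under commuting operators**: if `ρ g` commutes with every `ρ (ι t)` then `ρ g` maps the weight
space into itself. [folklore] -/
theorem map_mem_weightSpace_of_commute {g : G} (hg : ∀ t, Commute (ρ g) (ρ (ι t))) {v : V}
    (hv : v ∈ weightSpace ρ ι w) : ρ g v ∈ weightSpace ρ ι w := by
  rw [mem_weightSpace] at hv ⊢
  intro t
  have h := hg t
  rw [Commute, SemiconjBy] at h
  have h' := congrArg (fun f : Module.End R V => f v) h
  simp only [Module.End.mul_apply] at h'
  rw [← h', hv t, map_smul]

/-- The same for a group element commuting with every `ι t`. [folklore] -/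
theorem map_mem_weightSpace_of_commute' {g : G} (hg : ∀ t, Commute g (ι t)) {v : V}
    (hv : v ∈ weightSpace ρ ι w) : ρ g v ∈ weightSpace ρ ι w :=
  map_mem_weightSpace_of_commute (fun t => by
    have h := hg t
    rw [Commute, SemiconjBy] at h ⊢
    rw [← map_mul, h, map_mul]) hv

/-- Submodule form of the stability: `(weightSpace).map (ρ g) ≤ weightSpace`. [folklore] -/
theorem weightSpace_map_le_of_commute {g : G} (hg : ∀ t, Commute g (ι t)) :
    (weightSpace ρ ι w).map (ρ g) ≤ weightSpace ρ ι w := by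
  rintro _ ⟨v, hv, rfl⟩
  exact map_mem_weightSpace_of_commute' hg hv

/-- A weight vector is an eigenvector of each `ρ (ι t)`. [folklore] -/
theorem apply_of_mem_weightSpace {v : V} (hv : v ∈ weightSpace ρ ι w) (t : T) : ρ (ι t) v = w t • v :=
  mem_weightSpace.mp hv t

section Prod

variable {K H : Type*} [Monoid K] [Monoid H] {ρ₂ : Representation R (K × H) V} {T' : Type*}
  {ιK : T' → K} {w' : T' → R}

/-- **Product groups**: for a representation of `K × H` and weights of elements `(ιK t, 1)` of the first factor,
every `ρ (1, h)` preserves the weight space (`(k,1)` and `(1,h)` commute). Model case: the `κ`-isotypic subspace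
`𝒮^κ` for `K_∞ × 1 ⊂ U(V) × U(W)` is stable under `1 × U(W)(𝔸)`. [folklore] -/
theorem weightSpace_stable_inr (h : H) {v : V} (hv : v ∈ weightSpace ρ₂ (fun t => ((ιK t, 1) : K × H)) w') :
    ρ₂ (1, h) v ∈ weightSpace ρ₂ (fun t => ((ιK t, 1) : K × H)) w' :=
  map_mem_weightSpace_of_commute' (fun t => by
    rw [Commute, SemiconjBy, Prod.mk_mul_mk, Prod.mk_mul_mk, one_mul, mul_one, one_mul, mul_one]) hv

/-- The same, with the second-factor element written as `(k₀, h)` for `k₀` commuting with all `ιK t` (e.g.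
`k₀ = 1`, or `ιK` valued in the centre). [folklore] -/
theorem weightSpace_stable_of_commute_fst (k₀ : K) (h : H) (hk : ∀ t, Commute k₀ (ιK t)) {v : V}
    (hv : v ∈ weightSpace ρ₂ (fun t => ((ιK t, 1) : K × H)) w') :
    ρ₂ (k₀, h) v ∈ weightSpace ρ₂ (fun t => ((ιK t, 1) : K × H)) w' :=
  map_mem_weightSpace_of_commute' (fun t => by
    have hk' := hk t
    rw [Commute, SemiconjBy] at hk' ⊢
    rw [Prod.mk_mul_mk, Prod.mk_mul_mk, hk', one_mul, mul_one]) hv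

end Prod

section Topology

variable [TopologicalSpace V] [T2Space V] [ContinuousConstSMul R V]

/-- The weight space is closed as soon as the operators `ρ (ι t)` are continuous. [folklore] -/
theorem isClosed_weightSpace (hc : ∀ t, Continuous (ρ (ι t))) : IsClosed (weightSpace ρ ι w : Set V) := by
  have h : (weightSpace ρ ι w : Set V) = ⋂ t, {v : V | ρ (ι t) v = w t • v} := by
    ext v
    simp only [SetLike.mem_coe, mem_weightSpace, Set.mem_iInter, Set.mem_setOf_eq]
  rw [h]
  exact isClosed_iInter fun t => isClosed_eq (hc t) (continuous_id.const_smul (w t))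

end Topology

end Literature.RepresentationTheory
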